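import Summits.MatrixMultiplication.OmegaCensus.CentreIndexSixModel

/-!
# ω-census, family (b3): the class `𝒞₂` (centre quotient `Dih(C₃²)`) — finite fibre model, adjacency semantics, certificate checkers

HONEST FRAMING (pub-omega census; verbatim): lottery ticket; floor = certified bounds/negative ranges.
Census BOOKKEEPING (prereg P-031 of the cell, item .3, session A): the machine half of a certified NEGATIVE RANGE for single TPP
triples with two `3`-sets in the groups `G = C₃² ⋊_ε C` (`C` abelian acting through `±1`); nothing here is progress on `ω`.
This file is group-free.

THE MODEL (`d = 2` version of `CentreIndexSixModel`).  A label is an element of `G/Z(G) ≅ Dih(F₃²)`, encoded `l < 18`: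
coordinate `k = (l % 3, l / 3 % 3) ∈ F₃²`, sign bit `l / 9`; its component-`c` label `lab1 l c < 6` is a label of the `d = 1` model,
and the coordinate `d(p, p') ∈ F₃²` of a configuration `n < 18⁴` (labels of `t₁, t₂, u₁, u₂`; `t₀ = u₀ = 1`) is the tree's
`CentreIndexSix.dn` read componentwise (`dpp`).  Vertices `v = 9 p + a < 81` (`p < 9` the position `(t_{p/3}, u_{p%3})`, `a = a₀ + 3 a₁`
the lift `λ ∈ F₃²`); `v ~ w` iff the positions differ and `λ_w = λ_v − d(p_v, p_w)` or `λ_w = λ_v + d(p_w, p_v)` componentwise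
(`adj_iff`).  The `81 × 81` adjacency matrix is packed into one natural (`packAdj`), rows read by shifting (`adjRow`), exactly as
in the `d = 1` file.

The certificate checkers built on this model are in `DihC3SqCheckers`.
-/

open Finset

namespace Summit.MatrixMultiplication.OmegaCensus.DihC3Sq

open CentreIndexSix IndepSearch

/-! ## The model graph of a configuration -/

/-- Component-`c` (`c ∈ {0,1}`) `d = 1` label of the label `l < 18`. [folklore] -/
def lab1 (l c : ℕ) : ℕ := (l % 9) / 3 ^ c % 3 + 3 * (l / 9)

/-- `T`-labels of configuration `n`: `[0, n % 18, n / 18 % 18]`. [folklore] -/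
def labT (n i : ℕ) : ℕ := if i = 0 then 0 else if i = 1 then n % 18 else n / 18 % 18

/-- `U`-labels of configuration `n`: `[0, n / 324 % 18, n / 5832 % 18]`. [folklore] -/
def labU (n j : ℕ) : ℕ := if j = 0 then 0 else if j = 1 then n / 324 % 18 else n / 5832 % 18

/-- Component `c` of `d(p, p')` for positions `p = 3 i + j`, `p' = 3 i' + j'` (the tree's `d = 1` coordinate `dn`, componentwise).
[folklore] -/
def dpp (n p p' c : ℕ) : ℕ :=
  dn (lab1 (labT n (p / 3)) c) (lab1 (labT n (p' / 3)) c) (lab1 (labU n (p % 3)) c) (lab1 (labU n (p' % 3)) c)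

/-- The lift index `a = a₀ + 3 a₁` shifted by `(s₀, s₁)` componentwise `mod 3`. [folklore] -/
def shiftIdx (a s0 s1 : ℕ) : ℕ := (a % 3 + s0) % 3 + 3 * ((a / 3 % 3 + s1) % 3)

/-- Row of the vertex `(p, a)` restricted to the positions `< m`: at each position `p' ≠ p` the bits of the lifts
`a − d(p,p')` (written `a + 2 d`) and `a + d(p',p)`. [folklore] -/
def rowAcc (n p a : ℕ) : ℕ → ℕ
  | 0 => 0
  | m + 1 => rowAcc n p a m |||
      (if m = p then 0 else
        2 ^ (9 * m + shiftIdx a (2 * dpp n p m 0) (2 * dpp n p m 1)) ||| 2 ^ (9 * m + shiftIdx a (dpp n m p 0) (dpp n m p 1)))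

/-- Adjacency row of the vertex `v = 9 p + a` (a mask over the `81` vertices). [folklore] -/
def row (n v : ℕ) : ℕ := rowAcc n (v / 9) (v % 9) 9

/-- The first `m` rows packed into one natural (row `v` at bits `81 v … 81 v + 80`). [folklore] -/
def packRows (n : ℕ) : ℕ → ℕ
  | 0 => 0
  | m + 1 => packRows n m ||| (row n m <<< (81 * m))

/-- The packed `81 × 81` adjacency matrix of configuration `n`. [folklore] -/
def packAdj (n : ℕ) : ℕ := packRows n 81

/-- Row `v` of a packed matrix `A`. [folklore] -/
def adjRow (A v : ℕ) : ℕ := (A >>> (81 * v)) &&& (2 ^ 81 - 1)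

/-- Sorted configurations (`t₁ ≤ t₂`, `u₁ ≤ u₂` as labels). [folklore] -/
def sorted (n : ℕ) : Bool := decide (n % 18 ≤ n / 18 % 18) && decide (n / 324 % 18 ≤ n / 5832 % 18)

/-! ### Semantics of the masks (both directions) -/

/-- `shiftIdx a s₀ s₁ < 9`. [folklore] -/
theorem shiftIdx_lt (a s0 s1 : ℕ) : shiftIdx a s0 s1 < 9 := by unfold shiftIdx; omega

/-- Bits of `rowAcc`: exactly the two joined lifts at each position `p' < m`, `p' ≠ p`. [folklore] -/
theorem testBit_rowAcc (n p a : ℕ) : ∀ (m b : ℕ), (rowAcc n p a m).testBit b = true ↔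
    ∃ p' < m, p' ≠ p ∧ (b = 9 * p' + shiftIdx a (2 * dpp n p p' 0) (2 * dpp n p p' 1) ∨
      b = 9 * p' + shiftIdx a (dpp n p' p 0) (dpp n p' p 1))
  | 0, b => by simp [rowAcc]
  | m + 1, b => by
      rw [rowAcc, Nat.testBit_lor, Bool.or_eq_true, testBit_rowAcc n p a m b]
      constructor
      · rintro (⟨p', hp', hne, h⟩ | hb)
        · exact ⟨p', by omega, hne, h⟩
        · split_ifs at hb with hmp
          · simp at hb
          · rw [Nat.testBit_lor, Bool.or_eq_true, Nat.testBit_two_pow, Nat.testBit_two_pow] at hb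
            simp only [decide_eq_true_eq] at hb
            exact ⟨m, by omega, hmp, by omega⟩
      · rintro ⟨p', hp', hne, h⟩
        by_cases hpm : p' = m
        · subst hpm
          right
          rw [if_neg hne, Nat.testBit_lor, Bool.or_eq_true, Nat.testBit_two_pow, Nat.testBit_two_pow]
          simp only [decide_eq_true_eq]
          omega
        · exact Or.inl ⟨p', by omega, hne, h⟩

/-- `rowAcc n p a m < 2 ^ (9 m)`. [folklore] -/
theorem rowAcc_lt (n p a : ℕ) : ∀ m, rowAcc n p a m < 2 ^ (9 * m)
  | 0 => by simp [rowAcc]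
  | m + 1 => by
      rw [rowAcc]
      have h1 := rowAcc_lt n p a m
      have hpow : 2 ^ (9 * m) ≤ 2 ^ (9 * (m + 1)) := Nat.pow_le_pow_right (by norm_num) (by omega)
      refine Nat.or_lt_two_pow (lt_of_lt_of_le h1 hpow) ?_
      split_ifs
      · exact Nat.two_pow_pos _
      · have hs1 := shiftIdx_lt a (2 * dpp n p m 0) (2 * dpp n p m 1)
        have hs2 := shiftIdx_lt a (dpp n m p 0) (dpp n m p 1)
        exact Nat.or_lt_two_pow (Nat.pow_lt_pow_right (by norm_num) (by omega))
          (Nat.pow_lt_pow_right (by norm_num) (by omega))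

/-- `row n v < 2 ^ 81`. [folklore] -/
theorem row_lt (n v : ℕ) : row n v < 2 ^ 81 := by
  have := rowAcc_lt n (v / 9) (v % 9) 9; simpa [row] using this

/-- `packRows n m < 2 ^ (81 m)`. [folklore] -/
theorem packRows_lt (n : ℕ) : ∀ m, packRows n m < 2 ^ (81 * m)
  | 0 => by simp [packRows]
  | m + 1 => by
      rw [packRows]
      refine Nat.or_lt_two_pow (lt_of_lt_of_le (packRows_lt n m) (Nat.pow_le_pow_right (by norm_num) (by omega))) ?_
      rw [show 81 * (m + 1) = 81 + 81 * m by omega]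
      exact Nat.shiftLeft_lt (row_lt n m)

/-- Bits of `packRows`: bit `81 v + w` (`w < 81`) is bit `w` of row `v < m`. [folklore] -/
theorem testBit_packRows (n : ℕ) : ∀ (m v w : ℕ), w < 81 →
    ((packRows n m).testBit (81 * v + w) = true ↔ v < m ∧ (row n v).testBit w = true)
  | 0, v, w, _ => by simp [packRows]
  | m + 1, v, w, hw => by
      rw [packRows, Nat.testBit_lor, Bool.or_eq_true, testBit_packRows n m v w hw, Nat.testBit_shiftLeft, Bool.and_eq_true,
        decide_eq_true_eq]
      constructor
      · rintro (⟨hv, h⟩ | ⟨hge, h⟩)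
        · exact ⟨by omega, h⟩
        · have hvm : m ≤ v := by omega
          rcases Nat.eq_or_lt_of_le hvm with rfl | hlt
          · have : 81 * m + w - 81 * m = w := by omega
            rw [this] at h; exact ⟨by omega, h⟩
          · exfalso
            have hlt2 : row n m < 2 ^ (81 * v + w - 81 * m) :=
              lt_of_lt_of_le (row_lt n m) (Nat.pow_le_pow_right (by norm_num) (by omega))
            rw [Nat.testBit_lt_two_pow hlt2] at h
            exact Bool.false_ne_true h
      · rintro ⟨hv, h⟩
        rcases Nat.lt_succ_iff_lt_or_eq.1 hv with hlt | rfl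
        · exact Or.inl ⟨hlt, h⟩
        · right
          refine ⟨by omega, ?_⟩
          have : 81 * v + w - 81 * v = w := by omega
          rw [this]; exact h

/-- **Adjacency semantics (both directions).** Bit `w` of row `v` of `packAdj n` is set iff `v, w < 81`, the positions differ,
and `λ_w = λ_v − d(p_v,p_w)` or `λ_w = λ_v + d(p_w,p_v)` componentwise. [folklore] -/
theorem adj_iff (n v w : ℕ) : (adjRow (packAdj n) v).testBit w = true ↔
    v < 81 ∧ w < 81 ∧ v / 9 ≠ w / 9 ∧
      (w % 9 = shiftIdx (v % 9) (2 * dpp n (v / 9) (w / 9) 0) (2 * dpp n (v / 9) (w / 9) 1) ∨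
        w % 9 = shiftIdx (v % 9) (dpp n (w / 9) (v / 9) 0) (dpp n (w / 9) (v / 9) 1)) := by
  rw [adjRow, Nat.testBit_land, Bool.and_eq_true, Nat.testBit_shiftRight, Nat.testBit_two_pow_sub_one, decide_eq_true_eq]
  constructor
  · rintro ⟨hb, hw⟩
    obtain ⟨hv, hr⟩ := (testBit_packRows n 81 v w hw).1 hb
    obtain ⟨p', -, hne, h⟩ := (testBit_rowAcc n (v / 9) (v % 9) 9 w).1 (by simpa [row] using hr)
    have hs1 := shiftIdx_lt (v % 9) (2 * dpp n (v / 9) p' 0) (2 * dpp n (v / 9) p' 1)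
    have hs2 := shiftIdx_lt (v % 9) (dpp n p' (v / 9) 0) (dpp n p' (v / 9) 1)
    have hp : p' = w / 9 := by rcases h with h | h <;> omega
    subst hp
    refine ⟨hv, hw, fun e => hne e.symm, ?_⟩
    rcases h with h | h
    · left; omega
    · right; omega
  · rintro ⟨hv, hw, hne, h⟩
    refine ⟨(testBit_packRows n 81 v w hw).2 ⟨hv, ?_⟩, hw⟩
    rw [row]
    refine (testBit_rowAcc n (v / 9) (v % 9) 9 w).2 ⟨w / 9, by omega, fun e => hne e.symm, ?_⟩
    rcases h with h | h
    · left; omega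
    · right; omega

/-- A set bit of a row names a vertex `< 81`. [folklore] -/
theorem lt_of_adj {n v w : ℕ} (h : (adjRow (packAdj n) v).testBit w = true) : v < 81 ∧ w < 81 :=
  ⟨((adj_iff n v w).1 h).1, ((adj_iff n v w).1 h).2.1⟩

/-! ### Lift translations are automorphisms -/

/-- The lift translation `λ ↦ λ + (s₀, s₁)` on vertices. [folklore] -/
def transl (s0 s1 v : ℕ) : ℕ := 9 * (v / 9) + shiftIdx (v % 9) s0 s1

/-- Shifts commute. [folklore] -/
theorem shiftIdx_comm : ∀ a < 9, ∀ s0 < 3, ∀ s1 < 3, ∀ d0 < 3, ∀ d1 < 3,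
    shiftIdx (shiftIdx a d0 d1) s0 s1 = shiftIdx (shiftIdx a s0 s1) d0 d1 := by decide

/-- Shifting is injective in the lift. [folklore] -/
theorem shiftIdx_inj : ∀ a < 9, ∀ b < 9, ∀ s0 < 3, ∀ s1 < 3, shiftIdx a s0 s1 = shiftIdx b s0 s1 → a = b := by decide

/-- `shiftIdx` only sees its shift `mod 3`. [folklore] -/
theorem shiftIdx_mod (a s0 s1 : ℕ) : shiftIdx a s0 s1 = shiftIdx a (s0 % 3) (s1 % 3) := by
  unfold shiftIdx; omega

/-- `dpp < 3`. [folklore] -/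
theorem dpp_lt (n p p' c : ℕ) : dpp n p p' c < 3 := dn_lt _ _ _ _

/-- **Translation invariance.** `transl s v ~ transl s w ↔ v ~ w`. [folklore] -/
theorem testBit_adjRow_transl (n : ℕ) {s0 s1 : ℕ} (hs0 : s0 < 3) (hs1 : s1 < 3) (v w : ℕ) :
    (adjRow (packAdj n) (transl s0 s1 v)).testBit (transl s0 s1 w) = (adjRow (packAdj n) v).testBit w := by
  have key : ∀ x, ((adjRow (packAdj n) (transl s0 s1 v)).testBit (transl s0 s1 w) = true ↔ x) →
      ((adjRow (packAdj n) v).testBit w = true ↔ x) →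
      (adjRow (packAdj n) (transl s0 s1 v)).testBit (transl s0 s1 w) = (adjRow (packAdj n) v).testBit w := by
    intro x h1 h2
    rcases Bool.eq_false_or_eq_true ((adjRow (packAdj n) v).testBit w) with h | h
    · rw [h]; exact h1.2 (h2.1 h)
    · rw [h, Bool.eq_false_iff]; exact fun h' => absurd (h2.2 (h1.1 h')) (by simp [h])
  refine key _ (adj_iff n _ _) ?_
  rw [adj_iff n v w]
  have h1 := shiftIdx_lt (v % 9) s0 s1
  have h2 := shiftIdx_lt (w % 9) s0 s1
  have e1 : transl s0 s1 v / 9 = v / 9 := by unfold transl; omega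
  have e2 : transl s0 s1 w / 9 = w / 9 := by unfold transl; omega
  have e3 : transl s0 s1 v % 9 = shiftIdx (v % 9) s0 s1 := by unfold transl; omega
  have e4 : transl s0 s1 w % 9 = shiftIdx (w % 9) s0 s1 := by unfold transl; omega
  have ev : transl s0 s1 v < 81 ↔ v < 81 := by unfold transl; omega
  have ew : transl s0 s1 w < 81 ↔ w < 81 := by unfold transl; omega
  rw [e1, e2, e3, e4, ev, ew]
  have hv9 : v % 9 < 9 := Nat.mod_lt _ (by norm_num)
  have hw9 : w % 9 < 9 := Nat.mod_lt _ (by norm_num)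
  have A : ∀ d0 d1 : ℕ, (shiftIdx (w % 9) s0 s1 = shiftIdx (shiftIdx (v % 9) s0 s1) d0 d1 ↔
      w % 9 = shiftIdx (v % 9) d0 d1) := by
    intro d0 d1
    rw [shiftIdx_mod (shiftIdx (v % 9) s0 s1), shiftIdx_mod (v % 9) d0,
      ← shiftIdx_comm (v % 9) hv9 s0 hs0 s1 hs1 (d0 % 3) (Nat.mod_lt _ (by norm_num)) (d1 % 3) (Nat.mod_lt _ (by norm_num))]
    constructor
    · exact shiftIdx_inj _ hw9 _ (shiftIdx_lt _ _ _) s0 hs0 s1 hs1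
    · intro h; rw [h]
  rw [A, A]

end Summit.MatrixMultiplication.OmegaCensus.DihC3Sq
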